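import Summits.Parity.GeneralizedHardyLittlewood.Theorems.FordMaynardNoSieveConst0164NegWitness0164PinnedOrbit

/-!
# Route `FordMaynardNoSieveConst0164`, crux `NegWitness0164` (stmt-Parity-19102), line `birth`,
# stub `stub_tweakNeg0164`: cheap emptiness criteria for the pinned orbit images

Helper file (def-free).  In `sum_pinned_eq_sum_orbit_images` (`…PinnedOrbit`) a family `j = (j₀,j₁)` receives, from
each of the 97 listed tuples `u`, the image of the pinned part of the orbit of `u`.  For most `u` this image is EMPTY
for a trivially checkable reason — `j₀` (or `j₁`) is not a value of `u`, or `j₀ = j₁` occurs only once in `u` — so that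
only the tuples containing the frozen pair need the `decide` of `pinned_image_example_0164`.  K. Ford, J. Maynard,
arXiv:2407.14368, §8.

References: [FordMaynard2024PrimeSieves] arXiv:2407.14368, §8 (proof of Theorem 2.7 (c)); folklore.
-/

noncomputable section

open Finset
open scoped Classical

namespace Summit.Parity.GeneralizedHardyLittlewood.FordMaynardNoSieveConst0164NegWitness0164

/-- If `j₀` is not a value of `u`, no rearrangement of `u` ends with `(j₀, j₁)`: the pinned image is empty. [folklore] -/
theorem pinned_image_empty_of_ne_fst (u : Fin 5 → Fin 24) (j : Fin 2 → Fin 24) (h : ∀ i, u i ≠ j 0) :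
    ((Finset.univ.image (fun σ : Equiv.Perm (Fin 5) => (u ∘ ⇑σ : Fin 5 → Fin 24))).filter
        (fun t => (fun i : Fin 2 => t (Fin.natAdd 3 i)) = j)).image (fun t => (fun i : Fin 3 => t (Fin.castAdd 2 i))) = ∅ := by
  rw [Finset.image_eq_empty, Finset.filter_eq_empty_iff]
  intro t ht hpin
  obtain ⟨σ, -, rfl⟩ := Finset.mem_image.1 ht
  have := congrFun hpin 0
  exact h _ this

/-- If `j₁` is not a value of `u`, the pinned image is empty. [folklore] -/
theorem pinned_image_empty_of_ne_snd (u : Fin 5 → Fin 24) (j : Fin 2 → Fin 24) (h : ∀ i, u i ≠ j 1) :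
    ((Finset.univ.image (fun σ : Equiv.Perm (Fin 5) => (u ∘ ⇑σ : Fin 5 → Fin 24))).filter
        (fun t => (fun i : Fin 2 => t (Fin.natAdd 3 i)) = j)).image (fun t => (fun i : Fin 3 => t (Fin.castAdd 2 i))) = ∅ := by
  rw [Finset.image_eq_empty, Finset.filter_eq_empty_iff]
  intro t ht hpin
  obtain ⟨σ, -, rfl⟩ := Finset.mem_image.1 ht
  have := congrFun hpin 1
  exact h _ this

/-- If `j₀ = j₁` is a value of `u` at no two distinct indices, the pinned image is empty. [folklore] -/
theorem pinned_image_empty_of_single (u : Fin 5 → Fin 24) (j : Fin 2 → Fin 24) (hj : j 0 = j 1)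
    (h : ∀ i k, i ≠ k → u i = j 0 → u k ≠ j 0) :
    ((Finset.univ.image (fun σ : Equiv.Perm (Fin 5) => (u ∘ ⇑σ : Fin 5 → Fin 24))).filter
        (fun t => (fun i : Fin 2 => t (Fin.natAdd 3 i)) = j)).image (fun t => (fun i : Fin 3 => t (Fin.castAdd 2 i))) = ∅ := by
  rw [Finset.image_eq_empty, Finset.filter_eq_empty_iff]
  intro t ht hpin
  obtain ⟨σ, -, rfl⟩ := Finset.mem_image.1 ht
  have h0 : u (σ (Fin.natAdd 3 (0 : Fin 2))) = j 0 := congrFun hpin 0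
  have h1 : u (σ (Fin.natAdd 3 (1 : Fin 2))) = j 1 := congrFun hpin 1
  rw [← hj] at h1
  have hne : σ (Fin.natAdd 3 (0 : Fin 2)) ≠ σ (Fin.natAdd 3 (1 : Fin 2)) := by
    intro he
    have := σ.injective he
    exact absurd this (by decide)
  exact h _ _ hne h0 h1

/-- With an empty pinned image the contribution of `u` to a family sum vanishes. [folklore] -/
theorem pinned_term_zero_of_empty (u : Fin 5 → Fin 24) (j : Fin 2 → Fin 24) (W : (Fin 3 → Fin 24) → ℝ)
    (h : ((Finset.univ.image (fun σ : Equiv.Perm (Fin 5) => (u ∘ ⇑σ : Fin 5 → Fin 24))).filter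
        (fun t => (fun i : Fin 2 => t (Fin.natAdd 3 i)) = j)).image (fun t => (fun i : Fin 3 => t (Fin.castAdd 2 i))) = ∅) :
    lpTable0164 u * ∑ τ ∈ ((Finset.univ.image (fun σ : Equiv.Perm (Fin 5) => (u ∘ ⇑σ : Fin 5 → Fin 24))).filter
        (fun t => (fun i : Fin 2 => t (Fin.natAdd 3 i)) = j)).image (fun t => (fun i : Fin 3 => t (Fin.castAdd 2 i))),
        W τ = 0 := by
  rw [h, Finset.sum_empty, mul_zero]

end Summit.Parity.GeneralizedHardyLittlewood.FordMaynardNoSieveConst0164NegWitness0164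

end
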